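import Literature.Computability.Complexity.SpaceLoop
import Literature.Computability.Complexity.PlumbingBricks
import Literature.Computability.Complexity.FPStringBricks
import Literature.Computability.Complexity.LengthCompare
import HarnessLib

/-!
# Orbit deciders: languages decided by exponentially long orbits of an `FP` function are in `PSPACE`

Trunk toolkit on top of `SpaceLoop.lean` (`SpaceLoop.mem_PSPACE_of_bound_until_flag`: the space
machine iterating an `FP` function in place — Arora–Barak 2009, Thm. 4.2 and §4.1, "space can be
reused"). Every polynomial-space algorithm of the tree's `PSPACE` programme (the generic
`PSPACE`-complete bounded-halting language, `P^PSPACE ⊆ PSPACE`, `∃ᵖ·PSPACE ⊆ PSPACE`; Homer–Selman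
2011, §7.5.1, Prop. 7.5, Thm. 7.18) is of one shape, which this file isolates as a hypothesis
structure so that the machine-level argument is done ONCE:

* `OrbitDecider A` — an `FP` step `F`, an `FP` initialisation `ι`, an `FP` *unary budget* `Nu`
  and a polynomial `s` such that, on input `w`, the orbit `F^[k] (ι w)` stays of length
  `≤ s(|w|)`, `|Nu w| ≤ s(|w|)`, and after EXACTLY `2^{|Nu w|}` rounds the first symbol of the
  state is the answer `[w ∈ A]`;
* `OrbitDecider.mem_PSPACE` (**G0**): `A ∈ PSPACE` — the loop machine runs `F` with a binary
  round counter next to the state and raises the flag when the counter reaches `2^{|Nu w|}`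
  (length test `|counter| > |Nu w|`, `LengthCompare.lean`), exactly as in the tree's proof of
  `PP ⊆ PSPACE` (`MajorityEnumeration.lean`), whose bookkeeping is copied here;
* `OrbitDecider.preimage`, `OrbitDecider.ofKarpReducible` (**G1**): orbit deciders pull back
  along `FP` maps / Karp reductions (precompose `ι` and `Nu`).

The closure of orbit deciders under `∃ᵖ` and under `P^·` (restart the orbit for every
certificate / every oracle query) are the sequels; with the bounded-halting language they
discharge the named facts of `SpaceOracles.lean`.

## References

* S. Arora, B. Barak, *Computational Complexity: A Modern Approach*, CUP 2009, Thm. 4.2, §4.1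
  (space-bounded computation, reuse of space), §4.2 (`PSPACE`-completeness) [AroraBarakCC2009].
* S. Homer, A. L. Selman, *Computability and Complexity Theory*, 2nd ed., Springer 2011, Thm. 5.10
  (`NTIME(T) ⊆ DSPACE(T)` by enumeration in the space of one run), §7.5.1 [HomerSelman2011].
-/

noncomputable section

namespace Literature.Computability.Complexity

open _root_.Computability Polynomial Brick

/-- **Orbit decider** for a language `A`: an `FP` round function `F`, an `FP` initial state `ι w`,
an `FP` unary budget `Nu w` and one polynomial `s` bounding both the budget and every state of
the orbit, such that after exactly `2^{|Nu w|}` rounds the head symbol of the state tells whether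
`w ∈ A` (`List.headI`, default `false`). This is the data of a polynomial-SPACE algorithm that runs
for exponentially many polynomial-TIME rounds reusing its space.
[cite: AroraBarakCC2009, Thm. 4.2 and §4.1 (space-bounded computation; space is reused)] -/
structure OrbitDecider (A : Language Bool) where
  /-- the round function -/
  F : List Bool → List Bool
  /-- … is polynomial-time -/
  F_mem : F ∈ FP
  /-- the initial state of an input -/
  ι : List Bool → List Bool
  /-- … is polynomial-time -/
  ι_mem : ι ∈ FP
  /-- the unary budget: the orbit is read after `2 ^ |Nu w|` rounds -/
  Nu : List Bool → List Bool
  /-- … is polynomial-time -/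
  Nu_mem : Nu ∈ FP
  /-- the space polynomial -/
  s : Polynomial ℕ
  /-- the budget is polynomial -/
  Nu_le : ∀ w, (Nu w).length ≤ s.eval w.length
  /-- every state of the orbit is polynomially short -/
  size_le : ∀ w k, (F^[k] (ι w)).length ≤ s.eval w.length
  /-- after `2 ^ |Nu w|` rounds the head symbol is the answer -/
  correct : ∀ w, (F^[2 ^ (Nu w).length] (ι w)).headI = true ↔ w ∈ A

namespace OrbitDecider

/-! ### G1: pull-back along `FP` maps -/

/-- An `FP` function has polynomially bounded output length (`OutputsWithin.length_le`; twin of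
`exists_poly_length_le_of_mem_FP` of `CountingHierarchyProofs.lean`, not imported here).
[cite: AroraBarakCC2009, §1.3] -/
theorem exists_poly_length_le {f : List Bool → List Bool} (hf : f ∈ FP) :
    ∃ q : Polynomial ℕ, ∀ x, (f x).length ≤ q.eval x.length := by
  obtain ⟨p, M, hM⟩ := hf
  refine ⟨X + C (TM2Comp.machinePushBound M.tm) * p, fun x => ?_⟩
  have h := (hM x).length_le
  simpa using h

variable {A : Language Bool}

/-- **Orbit deciders pull back along `FP` maps**: precompose the initialisation and the budget
with `f`; the space polynomial becomes `s ∘ q` for an output bound `q` of `f`.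
[cite: AroraBarakCC2009, §4.2 (Def. 4.9: PSPACE is closed downwards under ≤ₚ)] -/
def preimage (D : OrbitDecider A) {f : List Bool → List Bool} (hf : f ∈ FP) :
    OrbitDecider (f ⁻¹' A) :=
  let q := Classical.choose (exists_poly_length_le hf)
  have hq : ∀ x, (f x).length ≤ q.eval x.length := Classical.choose_spec (exists_poly_length_le hf)
  { F := D.F
    F_mem := D.F_mem
    ι := D.ι ∘ f
    ι_mem := comp_mem_FP D.ι_mem hf
    Nu := D.Nu ∘ f
    Nu_mem := comp_mem_FP D.Nu_mem hf
    s := D.s.comp q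
    Nu_le := fun w => by
      rw [Function.comp_apply, eval_comp]
      exact (D.Nu_le (f w)).trans (TM2Iter.eval_mono D.s (hq w))
    size_le := fun w k => by
      rw [Function.comp_apply, eval_comp]
      exact (D.size_le (f w) k).trans (TM2Iter.eval_mono D.s (hq w))
    correct := fun w => D.correct (f w) }

/-- **Orbit deciders pull back along Karp reductions.** [cite: AroraBarakCC2009, §4.2 (Def. 4.9)] -/
def ofKarpReducible (D : OrbitDecider A) {L : Language Bool} (h : PolyTimeKarpReducible L A) :
    OrbitDecider L :=
  have hf : Classical.choose h ∈ FP := (Classical.choose_spec h).1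
  have hL : (Classical.choose h) ⁻¹' A = L :=
    Set.ext fun x => ((Classical.choose_spec h).2 x).symm
  hL ▸ D.preimage hf

/-! ### G0: the loop machine of an orbit decider -/

section Loop

variable (D : OrbitDecider A)

/-- The state `f a ⟨x, ⟨u, ⟨c, st⟩⟩⟩` of the loop: flag, answer, input, unary budget `u = Nu x`,
binary round counter `c`, current orbit state `st`. [cite: AroraBarakCC2009, §4.1 (reuse of space)] -/
def mkS (f a : Bool) (x u c st : List Bool) : List Bool :=
  f :: a :: boolPair x (boolPair u (boolPair c st))

/-- Length of a state. [folklore] -/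
theorem length_mkS (f a : Bool) (x u c st : List Bool) :
    (mkS f a x u c st).length = 2 * x.length + 2 * u.length + 2 * c.length + st.length + 8 := by
  simp only [mkS, length_boolPair, List.length_cons]
  ring

/-- Accessor: the body `⟨x, ⟨u, ⟨c, st⟩⟩⟩`. [folklore] -/
def bodyS : List Bool → List Bool := List.tail ∘ List.tail
/-- Accessor: the input. [folklore] -/
def xS : List Bool → List Bool := fstF ∘ bodyS
/-- Accessor: the budget. [folklore] -/
def uS : List Bool → List Bool := nthF 1 ∘ bodyS
/-- Accessor: the counter. [folklore] -/
def cS : List Bool → List Bool := nthF 2 ∘ bodyS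
/-- Accessor: the orbit state. [folklore] -/
def stS : List Bool → List Bool := sndPow 2 ∘ bodyS

/-- `bodyS` on a state. [folklore] -/
@[simp] theorem bodyS_mkS (f a : Bool) (x u c st : List Bool) :
    bodyS (mkS f a x u c st) = boolPair x (boolPair u (boolPair c st)) := rfl
/-- `xS` on a state. [folklore] -/
@[simp] theorem xS_mkS (f a : Bool) (x u c st : List Bool) : xS (mkS f a x u c st) = x := by
  simp [xS]
/-- `uS` on a state. [folklore] -/
@[simp] theorem uS_mkS (f a : Bool) (x u c st : List Bool) : uS (mkS f a x u c st) = u := by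
  simp [uS]
/-- `cS` on a state. [folklore] -/
@[simp] theorem cS_mkS (f a : Bool) (x u c st : List Bool) : cS (mkS f a x u c st) = c := by
  simp [cS]
/-- `stS` on a state. [folklore] -/
@[simp] theorem stS_mkS (f a : Bool) (x u c st : List Bool) : stS (mkS f a x u c st) = st := by
  simp [stS]
/-- The flag of a state. [folklore] -/
@[simp] theorem take1Fn_mkS (f a : Bool) (x u c st : List Bool) : take1Fn (mkS f a x u c st) = [f] := rfl

/-- The accessors are in `FP`. [folklore] -/
theorem bodyS_mem_FP : bodyS ∈ FP := comp_mem_FP PRelSigma.tail_mem_FP PRelSigma.tail_mem_FP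
/-- `xS ∈ FP`. [folklore] -/
theorem xS_mem_FP : xS ∈ FP := comp_mem_FP fstF_mem_FP bodyS_mem_FP
/-- `uS ∈ FP`. [folklore] -/
theorem uS_mem_FP : uS ∈ FP := comp_mem_FP (nthF_mem_FP 1) bodyS_mem_FP
/-- `cS ∈ FP`. [folklore] -/
theorem cS_mem_FP : cS ∈ FP := comp_mem_FP (nthF_mem_FP 2) bodyS_mem_FP
/-- `stS ∈ FP`. [folklore] -/
theorem stS_mem_FP : stS ∈ FP := comp_mem_FP (sndPow_mem_FP 2) bodyS_mem_FP

/-- **The head bit** of `g z` as a one-bit string: `[(g z).headI]` (`[false]` on `ε`). [folklore] -/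
def headBitFn (g : List Bool → List Bool) : List Bool → List Bool :=
  iteFn (isNilFn ∘ g) (fun _ => [false]) (take1Fn ∘ g)

/-- Semantics of `headBitFn`. [folklore] -/
theorem headBitFn_apply (g : List Bool → List Bool) (z : List Bool) : headBitFn g z = [(g z).headI] := by
  rw [headBitFn]
  cases h : g z with
  | nil => rw [iteFn_apply_true (by simp [isNilFn, h])]; rfl
  | cons b w => rw [iteFn_apply_false (by simp [isNilFn, h]), Function.comp_apply, h]; rfl

/-- `headBitFn g ∈ FP` for `g ∈ FP`. [folklore] -/
theorem headBitFn_mem_FP {g : List Bool → List Bool} (hg : g ∈ FP) : headBitFn g ∈ FP :=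
  iteFn_mem_FP (comp_mem_FP isNilFn_mem_FP hg) (const_mem_FP _) (comp_mem_FP take1Fn_mem_FP hg)

/-- The new counter `c + 1` in canonical binary. [folklore] -/
def cNew : List Bool → List Bool := addFn ∘ fanoutFn cS (fun _ => [true])
/-- The new orbit state `F st`. [folklore] -/
def stNew : List Bool → List Bool := D.F ∘ stS
/-- The new flag `[|u| < |c'|]`, i.e. `[c' ≥ 2^{|u|}]` for canonical `c'`. [folklore] -/
def fNew : List Bool → List Bool := notFn (lenLeFn X ∘ fanoutFn uS cNew)

/-- `cNew` on a state. [folklore] -/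
@[simp] theorem cNew_mkS (f a : Bool) (x u c st : List Bool) :
    cNew (mkS f a x u c st) = encodeNat (bitsToNat c + 1) := by
  simp [cNew]
/-- `stNew` on a state. [folklore] -/
@[simp] theorem stNew_mkS (f a : Bool) (x u c st : List Bool) : D.stNew (mkS f a x u c st) = D.F st := by
  simp [stNew]
/-- `fNew` on a state. [folklore] -/
theorem fNew_mkS (f a : Bool) (x u c st : List Bool) :
    fNew (mkS f a x u c st) = [decide (u.length < (encodeNat (bitsToNat c + 1)).length)] := by
  have h : (lenLeFn X ∘ fanoutFn uS cNew) (mkS f a x u c st) =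
      [decide ((encodeNat (bitsToNat c + 1)).length ≤ u.length)] := by
    simp [lenLeFn_boolPair]
  rw [fNew, notFn_apply h]
  by_cases hc : (encodeNat (bitsToNat c + 1)).length ≤ u.length
  · rw [decide_eq_true hc, decide_eq_false (Nat.not_lt.2 hc)]; rfl
  · rw [decide_eq_false hc, decide_eq_true (Nat.lt_of_not_le hc)]; rfl

/-- **One round of the loop** on an unflagged state:
`f a ⟨x,u,c,st⟩ ↦ [|u| < |c+1|] [head (F st)] ⟨x, u, c+1, F st⟩`. [cite: AroraBarakCC2009, §4.1 (reuse of space)] -/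
def stepS : List Bool → List Bool := fun w =>
  fNew w ++ (headBitFn D.stNew w ++ fanoutFn xS (fanoutFn uS (fanoutFn cNew D.stNew)) w)

/-- The round on a state. [folklore] -/
theorem stepS_mkS (f a : Bool) (x u c st : List Bool) :
    D.stepS (mkS f a x u c st) =
      mkS (decide (u.length < (encodeNat (bitsToNat c + 1)).length)) (D.F st).headI x u
        (encodeNat (bitsToNat c + 1)) (D.F st) := by
  rw [stepS, fNew_mkS, headBitFn_apply]
  simp only [fanoutFn_apply, xS_mkS, uS_mkS, cNew_mkS, stNew_mkS]
  rfl

/-- The round function: identity on flagged states. [folklore] -/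
def roundS : List Bool → List Bool := iteFn take1Fn id D.stepS

/-- The initial state of input `x`: `0 [head (ι x)] ⟨x, ⟨Nu x, ⟨ε, ι x⟩⟩⟩` (counter `0 = ε`).
[folklore] -/
def initS : List Bool → List Bool := fun x =>
  false :: (headBitFn D.ι x ++ fanoutFn id (fanoutFn D.Nu (fanoutFn (fun _ => []) D.ι)) x)

/-- The initial state. [folklore] -/
theorem initS_apply (x : List Bool) : D.initS x = mkS false (D.ι x).headI x (D.Nu x) [] (D.ι x) := by
  rw [initS, headBitFn_apply]
  simp only [fanoutFn_apply, id]
  rfl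

/-- **The loop function** handed to the loop machine: `0x ↦ initS x`, `1w ↦ roundS w`. [folklore] -/
def loopS : List Bool → List Bool :=
  iteFn take1Fn (D.roundS ∘ List.tail) (D.initS ∘ List.tail)

/-- `stepS ∈ FP`. [cite: AroraBarakCC2009, §1.3 (closure under composition)] -/
theorem stepS_mem_FP : D.stepS ∈ FP :=
  append_mem_FP
    (notFn_mem_FP (comp_mem_FP (lenLeFn_mem_FP X)
      (fanoutFn_mem_FP uS_mem_FP (comp_mem_FP addFn_mem_FP (fanoutFn_mem_FP cS_mem_FP (const_mem_FP _))))))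
    (append_mem_FP (headBitFn_mem_FP (comp_mem_FP D.F_mem stS_mem_FP))
      (fanoutFn_mem_FP xS_mem_FP (fanoutFn_mem_FP uS_mem_FP
        (fanoutFn_mem_FP (comp_mem_FP addFn_mem_FP (fanoutFn_mem_FP cS_mem_FP (const_mem_FP _)))
          (comp_mem_FP D.F_mem stS_mem_FP)))))

/-- `roundS ∈ FP`. [cite: AroraBarakCC2009, §1.3] -/
theorem roundS_mem_FP : D.roundS ∈ FP := iteFn_mem_FP take1Fn_mem_FP OracleCompose.id_mem_FP D.stepS_mem_FP

/-- `initS ∈ FP`. [cite: AroraBarakCC2009, §1.3] -/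
theorem initS_mem_FP : D.initS ∈ FP :=
  comp_mem_FP (cons_mem_FP false)
    (append_mem_FP (headBitFn_mem_FP D.ι_mem)
      (fanoutFn_mem_FP OracleCompose.id_mem_FP
        (fanoutFn_mem_FP D.Nu_mem (fanoutFn_mem_FP (const_mem_FP _) D.ι_mem))))

/-- `loopS ∈ FP`. [cite: AroraBarakCC2009, §1.3] -/
theorem loopS_mem_FP : D.loopS ∈ FP :=
  iteFn_mem_FP take1Fn_mem_FP (comp_mem_FP D.roundS_mem_FP PRelSigma.tail_mem_FP)
    (comp_mem_FP D.initS_mem_FP PRelSigma.tail_mem_FP)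

/-- The `k`-th state of the loop on input `x`. [folklore] -/
def stateAt (x : List Bool) (k : ℕ) : List Bool :=
  mkS (decide (2 ^ (D.Nu x).length ≤ k)) (D.F^[k] (D.ι x)).headI x (D.Nu x) (encodeNat k) (D.F^[k] (D.ι x))

/-- A canonical counter `bin k` reaches length `> n` exactly when `k ≥ 2^n`. [folklore] -/
theorem lt_length_encodeNat_iff (n k : ℕ) : n < (encodeNat k).length ↔ 2 ^ n ≤ k := by
  rw [TM2Pass.length_encodeNat_eq_size, Nat.lt_size]

/-- One round from the `k`-th state, `k < 2^{|Nu x|}`, gives the `(k+1)`-st. [folklore] -/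
theorem roundS_stateAt (x : List Bool) {k : ℕ} (hk : k < 2 ^ (D.Nu x).length) :
    D.roundS (D.stateAt x k) = D.stateAt x (k + 1) := by
  rw [stateAt, decide_eq_false (Nat.not_le.2 hk), roundS, iteFn_apply_false (take1Fn_mkS _ _ _ _ _ _),
    stepS_mkS, bitsToNat_encodeNat, stateAt, Function.iterate_succ_apply']
  congr 1
  exact Bool.decide_congr (lt_length_encodeNat_iff _ _)

/-- **The orbit of the loop machine** is the sequence of states, up to round `2^{|Nu x|}`.
[cite: AroraBarakCC2009, §4.1] -/
theorem orbit_loopS (x : List Bool) {k : ℕ} (hk : k ≤ 2 ^ (D.Nu x).length) :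
    SpaceLoop.orbit D.loopS x k = D.stateAt x k := by
  induction k with
  | zero =>
    rw [SpaceLoop.orbit_zero, loopS, iteFn_apply_false (show take1Fn (false :: x) = [false] from rfl),
      Function.comp_apply, List.tail_cons, initS_apply, stateAt]
    simp only [Function.iterate_zero, id_eq, Nat.le_zero]
    rw [decide_eq_false (Nat.pos_iff_ne_zero.1 (Nat.two_pow_pos _))]
    rfl
  | succ k ih =>
    rw [SpaceLoop.orbit_succ, ih (Nat.le_of_succ_le hk), loopS,
      iteFn_apply_true (show take1Fn (true :: D.stateAt x k) = [true] from rfl), Function.comp_apply,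
      List.tail_cons, roundS_stateAt D x hk]

end Loop

/-- **G0. An orbit decider puts its language in `PSPACE`.** The loop machine of `SpaceLoop.lean`
iterates `loopS ∈ FP`; its orbit is unflagged before round `2^{|Nu x|}` and flagged there with the
answer bit `[x ∈ A]` (`correct`), and every orbit word is polynomially short (`size_le`, `Nu_le`,
the counter has `≤ |Nu x| + 1` bits). [cite: AroraBarakCC2009, Thm. 4.2 and §4.1 (space-bounded iteration reusing the space of one polynomial-time round)] -/
theorem mem_PSPACE (D : OrbitDecider A) : A ∈ PSPACE := by
  refine SpaceLoop.mem_PSPACE_of_bound_until_flag D.loopS_mem_FP (2 * X + 5 * D.s + 10) ?_ ?_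
  · -- size bound before the flag
    intro x k hk
    have hk' : k ≤ 2 ^ (D.Nu x).length := by
      by_contra h
      obtain ⟨w', hw'⟩ := hk (2 ^ (D.Nu x).length) (Nat.lt_of_not_le h)
      rw [orbit_loopS D x le_rfl, stateAt, decide_eq_true le_rfl] at hw'
      exact Bool.noConfusion (List.cons.inj hw').1
    rw [orbit_loopS D x hk', stateAt, length_mkS]
    have h1 := D.Nu_le x
    have h2 := D.size_le x k
    have h3 : (encodeNat k).length ≤ (D.Nu x).length + 1 := by
      rw [TM2Pass.length_encodeNat_eq_size, Nat.size_le]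
      calc k ≤ 2 ^ (D.Nu x).length := hk'
        _ < 2 ^ ((D.Nu x).length + 1) := Nat.pow_lt_pow_right (by norm_num) (Nat.lt_succ_self _)
    simp only [eval_add, eval_mul, eval_ofNat, eval_X]
    omega
  · -- the flag is raised at round `2^{|Nu x|}` with the answer, and not before
    intro x
    refine ⟨2 ^ (D.Nu x).length, boolPair x (boolPair (D.Nu x)
      (boolPair (encodeNat (2 ^ (D.Nu x).length)) (D.F^[2 ^ (D.Nu x).length] (D.ι x)))), ?_, ?_⟩
    · rw [orbit_loopS D x le_rfl, stateAt, decide_eq_true le_rfl, mkS]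
      congr 2
      rcases Bool.eq_false_or_eq_true (A.boolIndicator x) with h | h
      · rw [h]; exact (D.correct x).2 ((Set.mem_iff_boolIndicator _ _).2 h)
      · rw [h]
        cases hb : (D.F^[2 ^ (D.Nu x).length] (D.ι x)).headI
        · rfl
        · exact absurd ((Set.mem_iff_boolIndicator _ _).1 ((D.correct x).1 hb)) (by rw [h]; simp)
    · intro k hk
      exact ⟨_, by rw [orbit_loopS D x hk.le, stateAt, decide_eq_false (Nat.not_le.2 hk), mkS]⟩

end OrbitDecider

/-- **A language with an orbit decider is in `PSPACE`** (restatement with the structure as a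
hypothesis). [cite: AroraBarakCC2009, Thm. 4.2 and §4.1] -/
theorem mem_PSPACE_of_orbitDecider {A : Language Bool} (D : OrbitDecider A) : A ∈ PSPACE :=
  D.mem_PSPACE

/-- **Karp preimages of orbit-decided languages are in `PSPACE`.** [cite: AroraBarakCC2009, §4.2 (Def. 4.9)] -/
theorem mem_PSPACE_of_karpReducible_orbitDecider {A L : Language Bool} (D : OrbitDecider A)
    (h : PolyTimeKarpReducible L A) : L ∈ PSPACE :=
  (D.ofKarpReducible h).mem_PSPACE

end Literature.Computability.Complexity
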